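import Literature.NumberTheory.GaloisRepresentations.LocalFieldCdTwo
import Literature.AnabelianGeometry.AbsoluteAnabelian.ZHatCompletionFreeProcyclic
import HarnessLib

/-!
# `cd(Ẑ) ≤ 1`: a free procyclic profinite group has `H²(G, B) = 0` for every finite discrete
# `G`-module `B`, hence `p`-cohomological dimension `≤ 1` for every prime `p`

abc-iut cell, layer L4.  PROOF file (no definition, no named fact).  The cell's intrinsic predicate
`FundamentalExtension.IsFreeProcyclic G` ("`≅ Ẑ`": a dense cyclic subgroup and an open subgroup of
every positive index; [AbsTopI] §0 p. 7 "the profinite completion of the group `ℤ`", [AbsTopIII]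
Prop. 1.4 (i) p. 31 "the inertia group `I_x` … is naturally isomorphic to `Ẑ(1)`") is the shape in
which the groups `Ẑ` of the absolute anabelian texts enter the tree: cuspidal inertia groups `I_x`
(`FundamentalExtension.InertiaFreeProcyclic`, `CuspidalData`), the unramified quotients
`Gal(k^nr/k) = Γ_k ⧸ galUnr k` (`isFreeProcyclic_quotient_galUnr`, `LocalUnramifiedQuotientH2.lean`),
Mathlib's profinite completion of `ℤ` (`isFreeProcyclic_zHatCompletion`).  This file proves, for ANY
such `G` (profinite) and any finite discrete `G`-module `B` with arbitrary continuous action: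

* `subsingleton_continuousCohomology_two_of_finite_of_dense_zpowers` /
  `FundamentalExtension.IsFreeProcyclic.subsingleton_continuousCohomology_two_of_finite` —
  **`H²(G, B) = 0`**;
* `FundamentalExtension.IsFreeProcyclic.groupCdLE_one` — **`cd_p(G) ≤ 1` for every prime `p`**
  (the tree's `GroupCdLE`, via `subsingleton_of_forall_finite` + `groupCdLE_one_of_forall_subsingleton_two`);
* `groupCdLE_one_zHatCompletion` — `cd_p(Ẑ) ≤ 1` for Mathlib's `Ẑ`.

The argument is the one the tree runs for `Gal(F^nr/F)` in `LocalFieldCdTwo.lean`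
(`subsingleton_two_quotient_galUnr_of_finite`, Serre, *Cohomologie galoisienne* II §4.3 Prop. 12,
"`cd(Ẑ) = 1`"), with the arithmetic Frobenius replaced by a dense generator `γ` and the unramified
extension of degree `m` by an open subgroup of index `m`: a continuous `2`-cocycle `z` is right-invariant
under an open normal `W` acting trivially on `B`; every finite quotient of `G` is cyclic on the image
of `γ` (`exists_pow_eq_mk_of_dense_zpowers`); inside `W ∩ N`, `N` open normal of index divisible by
`#B · (G : W)`, the norm sum of `z` over one period of `γ̄` vanishes (`frobSum_eq_zero_of_dvd`), so `z`
is the explicit coboundary of `CyclicQuotientTwoCocycle.lean` (`twoCocycleClass_eq_zero_of_cyclicQuotient`).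
HONEST FRAMING: classical (Serre); nothing here bears on [IUTchIII] Cor. 3.12 or takes a side.
-/

noncomputable section

open CategoryTheory Function
open ProfiniteGrp ProfiniteGrp.ProfiniteCompletion

universe u

namespace Literature.AnabelianGeometry.AbsoluteAnabelian

open Literature.NumberTheory.GaloisRepresentations
open _root_.TopRep _root_.ContRepresentation _root_.ContinuousCohomology _root_.Topology _root_.Filter

section DenseGenerator

variable {G : Type u} [Group G] [TopologicalSpace G] [IsTopologicalGroup G] [CompactSpace G]

/-- **Finite quotients of a group with a dense cyclic subgroup are cyclic on the image of the
generator**: for an open normal subgroup `H`, every element of `G ⧸ H` is a natural power of `γ̄`.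
[cite: SerreGaloisCohomology1997, II §4.3 Prop. 12] -/
theorem exists_pow_eq_mk_of_dense_zpowers {γ : G} (hγ : Dense (Subgroup.zpowers γ : Set G))
    (H : Subgroup G) [H.Normal] (hH : IsOpen (H : Set G)) (q : G ⧸ H) :
    ∃ i : ℕ, q = (QuotientGroup.mk γ : G ⧸ H) ^ i := by
  haveI : DiscreteTopology (G ⧸ H) := QuotientGroup.discreteTopology hH
  haveI : Finite (G ⧸ H) := Subgroup.quotient_finite_of_isOpen H hH
  have hdense : Dense (Subgroup.zpowers (QuotientGroup.mk γ : G ⧸ H) : Set (G ⧸ H)) := by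
    have h1 : (Subgroup.zpowers (QuotientGroup.mk γ : G ⧸ H) : Set (G ⧸ H)) =
        QuotientGroup.mk' H '' (Subgroup.zpowers γ : Set G) := by
      rw [← Subgroup.coe_map, MonoidHom.map_zpowers, QuotientGroup.mk'_apply]
    rw [h1]
    exact (QuotientGroup.mk'_surjective H).denseRange.dense_image QuotientGroup.continuous_mk hγ
  have hmem : q ∈ Subgroup.zpowers (QuotientGroup.mk γ : G ⧸ H) := by
    have hq : q ∈ closure (Subgroup.zpowers (QuotientGroup.mk γ : G ⧸ H) : Set (G ⧸ H)) := hdense q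
    rwa [(isClosed_discrete _).closure_eq] at hq
  rw [← (isOfFinOrder_of_finite _).mem_powers_iff_mem_zpowers, Submonoid.mem_powers_iff] at hmem
  obtain ⟨i, hi⟩ := hmem
  exact ⟨i, hi.symm⟩

/-- In a finite quotient by an open normal subgroup, the image of a dense generator has order equal to
the index. [cite: SerreGaloisCohomology1997, II §4.3 Prop. 12] -/
theorem orderOf_mk_eq_index_of_dense_zpowers {γ : G} (hγ : Dense (Subgroup.zpowers γ : Set G))
    (H : Subgroup G) [H.Normal] (hH : IsOpen (H : Set G)) :
    orderOf (QuotientGroup.mk γ : G ⧸ H) = H.index := by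
  haveI : Finite (G ⧸ H) := Subgroup.quotient_finite_of_isOpen H hH
  rw [Subgroup.index, orderOf_eq_card_of_forall_mem_zpowers]
  intro q
  obtain ⟨i, rfl⟩ := exists_pow_eq_mk_of_dense_zpowers hγ H hH q
  exact Subgroup.pow_mem _ (Subgroup.mem_zpowers _) i

variable [T2Space G] [TotallyDisconnectedSpace G]

/-- **`H²(G, B) = 0` for `G ≅ Ẑ` and `B` a finite discrete `G`-module** (any continuous action):
`G` profinite with a dense cyclic subgroup `γ^ℤ` and an open subgroup of every positive index.  A
continuous `2`-cocycle is inflated from a finite cyclic quotient `G ⧸ W` generated by `γ̄` (`W` open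
normal, acting trivially on `B`), and its norm sum over one period of `γ̄` modulo the deeper open
normal subgroup `W ∩ N`, `(G : N)` divisible by `#B · (G : W)`, vanishes; then it is a coboundary
(`twoCocycleClass_eq_zero_of_cyclicQuotient`). [cite: SerreGaloisCohomology1997, II §4.3 Prop. 12] -/
theorem subsingleton_continuousCohomology_two_of_finite_of_dense_zpowers {γ : G}
    (hγ : Dense (Subgroup.zpowers γ : Set G))
    (hidx : ∀ n : ℕ, 0 < n → ∃ H : Subgroup G, IsOpen (H : Set G) ∧ H.index = n)
    (B : Type u) [AddCommGroup B] [TopologicalSpace B] [DiscreteTopology B] [Finite B]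
    (τ : ContinuousRep G ℤ B) : Subsingleton (continuousCohomology 2 τ.toTopRep) := by
  classical
  refine subsingleton_of_forall_eq 0 fun x => ?_
  obtain ⟨z, rfl⟩ := twoCocycleClass_surjective _ x
  -- the (open) joint stabiliser of `B`
  have hker : (⋂ b : B, {σ : G | τ σ b = b}) ∈ 𝓝 (1 : G) :=
    (Filter.iInter_mem).2 fun b => τ.setOf_apply_eq_mem_nhds_one b
  -- uniform local constancy of `z` on `G × G`
  obtain ⟨V, hV, hVz⟩ := exists_nhds_one_forall_eq' (X := G × G) (P := G × G)
    (fun a v => z.1 (a * v)) (z.1.continuous.comp continuous_mul)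
  obtain ⟨V₁, hV₁, V₂, hV₂, hV₁₂⟩ := mem_nhds_prod_iff.1 hV
  have h1 : (1 : G) ∈ interior ((⋂ b : B, {σ : G | τ σ b = b}) ∩ (V₁ ∩ V₂)) :=
    mem_interior_iff_mem_nhds.2 (inter_mem hker (inter_mem hV₁ hV₂))
  obtain ⟨W, hW⟩ := ProfiniteGrp.exist_openNormalSubgroup_sub_open_nhds_of_one isOpen_interior h1
  have hW' : (W : Set G) ⊆ (⋂ b : B, {σ | τ σ b = b}) ∩ (V₁ ∩ V₂) := hW.trans interior_subset
  have h1V₁ : (1 : G) ∈ V₁ := mem_of_mem_nhds hV₁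
  have h1V₂ : (1 : G) ∈ V₂ := mem_of_mem_nhds hV₂
  -- right invariance of `z` under `W` and triviality of the action of `W`
  have hz₁ : ∀ (a b : G), ∀ h ∈ (W : Subgroup G), z.1 (a * h, b) = z.1 (a, b) := by
    intro a b h hh
    have hmem : ((h, 1) : G × G) ∈ V := hV₁₂ (Set.mk_mem_prod (hW' hh).2.1 h1V₂)
    have e : z.1 ((a, b) * (h, 1)) = z.1 ((a, b) * 1) := hVz (a, b) (h, 1) hmem
    rwa [Prod.mk_mul_mk, mul_one, mul_one] at e
  have hz₂ : ∀ (a b : G), ∀ h ∈ (W : Subgroup G), z.1 (a, b * h) = z.1 (a, b) := by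
    intro a b h hh
    have hmem : ((1, h) : G × G) ∈ V := hV₁₂ (Set.mk_mem_prod h1V₁ (hW' hh).2.2)
    have e : z.1 ((a, b) * (1, h)) = z.1 ((a, b) * 1) := hVz (a, b) (1, h) hmem
    rwa [Prod.mk_mul_mk, mul_one, mul_one] at e
  have hHX : ∀ h ∈ (W : Subgroup G), ∀ b : B, τ.toTopRep.ρ h b = b := by
    intro h hh b
    rw [ContinuousRep.toTopRep_ρ_apply]
    exact Set.mem_iInter.1 (hW' hh).1 b
  -- the period `n₀` of `γ̄` modulo `W`, and the deeper level `H₁ = W ∩ N`, `#B · n₀ ∣ (G : N)`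
  haveI : Finite (G ⧸ (W : Subgroup G)) := Subgroup.quotient_finite_of_isOpen _ W.isOpen'
  set n₀ : ℕ := orderOf (QuotientGroup.mk γ : G ⧸ (W : Subgroup G)) with hn₀
  have hn₀pos : 0 < n₀ := orderOf_pos _
  set m : ℕ := Nat.card B * n₀ with hmdef
  have hm : 0 < m := Nat.mul_pos Nat.card_pos hn₀pos
  obtain ⟨U, hUo, hUi⟩ := hidx m hm
  obtain ⟨N, hNU⟩ := ProfiniteGrp.exist_openNormalSubgroup_sub_open_nhds_of_one hUo U.one_mem
  let H₁ : Subgroup G := (W : Subgroup G) ⊓ (N : Subgroup G)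
  haveI : H₁.Normal := inferInstance
  have hH₁o : IsOpen (H₁ : Set G) := W.isOpen'.inter N.isOpen'
  have hH₁₀ : H₁ ≤ (W : Subgroup G) := inf_le_left
  have hH₁U : H₁ ≤ U := fun g hg => hNU (inf_le_right (a := (W : Subgroup G)) hg)
  haveI : Finite (G ⧸ H₁) := Subgroup.quotient_finite_of_isOpen H₁ hH₁o
  set n₁ : ℕ := orderOf (QuotientGroup.mk γ : G ⧸ H₁) with hn₁
  -- `γ̄` generates `G ⧸ H₁`, so `n₁ = (G : H₁)` is a multiple of `(G : U) = m`
  have hn₁idx : n₁ = H₁.index := orderOf_mk_eq_index_of_dense_zpowers hγ H₁ hH₁o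
  have hmn₁ : m ∣ n₁ := by
    rw [hn₁idx, ← hUi]
    exact Subgroup.index_dvd_of_le hH₁U
  have hpow₁ : γ ^ n₁ ∈ H₁ := by
    rw [← QuotientGroup.eq_one_iff, QuotientGroup.mk_pow, hn₁]
    exact pow_orderOf_eq_one _
  -- `n₀ ∣ n₁`
  have hn₀₁ : n₀ ∣ n₁ := by
    rw [hn₀]
    apply orderOf_dvd_of_pow_eq_one
    rw [← QuotientGroup.mk_pow, QuotientGroup.eq_one_iff]
    exact hH₁₀ hpow₁
  obtain ⟨k, hk⟩ := hn₀₁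
  have hNk : Nat.card B ∣ k := by
    have h := hmn₁
    rw [hk, hmdef, mul_comm (Nat.card B) n₀] at h
    exact Nat.dvd_of_mul_dvd_mul_left hn₀pos h
  -- the norm sum over one period modulo `H₁` vanishes
  have hsum : frobSum z γ (orderOf (QuotientGroup.mk γ : G ⧸ H₁)) = 0 := by
    rw [← hn₁, hk]
    refine frobSum_eq_zero_of_dvd (H₀ := (W : Subgroup G)) hz₁ ?_ (fun b : B => card_nsmul_eq_zero') hNk
    rw [← QuotientGroup.eq_one_iff, QuotientGroup.mk_pow, hn₀]
    exact pow_orderOf_eq_one _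
  -- conclude with the explicit coboundary of `CyclicQuotientTwoCocycle`
  exact twoCocycleClass_eq_zero_of_cyclicQuotient H₁ γ z (exists_pow_eq_mk_of_dense_zpowers hγ H₁ hH₁o)
    hH₁o (fun a b h hh => hz₁ a b h (hH₁₀ hh)) (fun a b h hh => hz₂ a b h (hH₁₀ hh))
    (fun h hh b => hHX h (hH₁₀ hh) b) hsum

/-- **`H²(G, B) = 0` for a free procyclic profinite group `G` and a finite discrete `G`-module `B`.**
[cite: SerreGaloisCohomology1997, II §4.3 Prop. 12] -/
theorem FundamentalExtension.IsFreeProcyclic.subsingleton_continuousCohomology_two_of_finite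
    (h : FundamentalExtension.IsFreeProcyclic G)
    (B : Type u) [AddCommGroup B] [TopologicalSpace B] [DiscreteTopology B] [Finite B]
    (τ : ContinuousRep G ℤ B) : Subsingleton (continuousCohomology 2 τ.toTopRep) := by
  obtain ⟨γ, hγ⟩ := h.exists_dense_zpowers
  exact subsingleton_continuousCohomology_two_of_finite_of_dense_zpowers hγ h.exists_isOpen_index B τ

/-- **`cd_p(Ẑ) ≤ 1`: a free procyclic profinite group has `p`-cohomological dimension `≤ 1` for
every prime `p`** (`H²` vanishes on finite `p`-primary modules, hence on all `p`-primary torsion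
discrete modules by the tree's reduction to finite coefficients, hence `cd_p ≤ 1` by Serre I §3.1
Prop. 11 in the tree's form). [cite: SerreGaloisCohomology1997, II §4.3 Prop. 12] -/
theorem FundamentalExtension.IsFreeProcyclic.groupCdLE_one (h : FundamentalExtension.IsFreeProcyclic G)
    (p : ℕ) [hp : Fact p.Prime] : GroupCdLE G p 1 :=
  groupCdLE_one_of_forall_subsingleton_two fun _ _ _ _ ρ hM =>
    subsingleton_of_forall_finite ρ hp.out.ne_zero 1
      (fun B _ _ _ _ τ _ => h.subsingleton_continuousCohomology_two_of_finite B τ) hM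

end DenseGenerator

/-- **`cd_p(Ẑ) ≤ 1` for Mathlib's profinite completion `Ẑ` of `ℤ`**, every prime `p`.
[cite: SerreGaloisCohomology1997, II §4.3 Prop. 12] -/
theorem groupCdLE_one_zHatCompletion (p : ℕ) [Fact p.Prime] :
    GroupCdLE (completion (GrpCat.of (Multiplicative ℤ))) p 1 :=
  isFreeProcyclic_zHatCompletion.groupCdLE_one p

end Literature.AnabelianGeometry.AbsoluteAnabelian

end
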